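import Literature.Geometry.DiscreteGeometry.ThreePointKernelGeneral
import Summits.Ventures.PackingBounds.Energy.ChebyshevUExplicit
import Summits.Ventures.PackingBounds.Configurations.OrthogonalPentagons
import Summits.Ventures.PackingBounds.Configurations.PetersenCode
import HarnessLib

/-!
# Ten points on `S³`, potentials `(1+⟪x,y⟫)` and `(1+⟪x,y⟫)²`: the two-point bounds `80` and `85` are sharp (both codes tie)

Framing: lottery ticket; floor = certified bounds/negative ranges. Venture `PackingBounds`, cell
`pub-packcert`, energy family (pub-packcert-energy gen 14).

The cases `k = 1, 2` of the ten-point `(1+t)^k` problems on `S³` (Cohn–Woo 2012 §5.3: "for `k ≤ 2` both codes have the same energy and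
the two-point bounds are sharp"): `1 + t = 1 + (1/2)U₁` and `(1+t)² = 5/4 + U₁ + (1/4)U₂` in the basis `C_k^1 = U_k`, so
`Σ_{x≠y}(1+⟪x,y⟫) ≥ 100 - 20 = 80` and `Σ_{x≠y}(1+⟪x,y⟫)² ≥ 125 - 40 = 85` for every ten unit vectors of `ℝ⁴`, attained by two orthogonal
pentagons AND by the Petersen code (`ck1/ck2_ten_points`, `…_isLeast`, `petersen_ck1/ck2_energy`).
-/

noncomputable section

open Finset
open scoped RealInnerProductSpace

namespace Summit.Ventures.PackingBounds.Energy.TenPointCkSmall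

open Literature.Geometry.DiscreteGeometry Literature.Geometry.DiscreteGeometry.BachocVallentin
open Literature.Analysis.SpecialFunctions Summit.Ventures.PackingBounds.Energy Summit.Ventures.PackingBounds.Config

/-- Coefficients of `(1+t) - 1` in the basis `U_k`: `1/2` at `k = 1`. -/
def acoT1 : ℕ → ℝ
  | 1 => 1 / 2
  | _ => 0

/-- Coefficients of `(1+t)² - 5/4` in the basis `U_k`: `1, 1/4` at `k = 1, 2`. -/
def acoT2 : ℕ → ℝ
  | 1 => 1
  | 2 => 1 / 4
  | _ => 0

/-- Nonnegativity. -/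
theorem aco_nonnegT1 (k : ℕ) : 0 ≤ acoT1 k := by
  unfold acoT1; split <;> norm_num

/-- Nonnegativity. -/
theorem aco_nonnegT2 (k : ℕ) : 0 ≤ acoT2 k := by
  unfold acoT2; split <;> norm_num

/-- `Σ_{k ≤ 1} aco_k U_k(w) = (1+w) - 1`. -/
theorem aeval_T1 (w : ℝ) :
    (∑ k ∈ range (1 + 1), acoT1 k * gegenbauerSum ((((4 : ℕ) : ℝ) - 2) / 2) k w) = (1 + w) - 1 := by
  have hμ : ((((4 : ℕ) : ℝ) - 2) / 2) = (1 : ℝ) := by norm_num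
  rw [hμ]
  have h0 : acoT1 0 = 0 := rfl
  have h1 : acoT1 1 = 1 / 2 := rfl
  simp only [Finset.sum_range_succ, Finset.sum_range_zero, h0, h1, ChebyshevU.c1_0, ChebyshevU.c1_1]
  ring

/-- `Σ_{k ≤ 2} aco_k U_k(w) = (1+w)² - 5/4`. -/
theorem aeval_T2 (w : ℝ) :
    (∑ k ∈ range (2 + 1), acoT2 k * gegenbauerSum ((((4 : ℕ) : ℝ) - 2) / 2) k w) = (1 + w) ^ 2 - 5 / 4 := by
  have hμ : ((((4 : ℕ) : ℝ) - 2) / 2) = (1 : ℝ) := by norm_num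
  rw [hμ]
  have h0 : acoT2 0 = 0 := rfl
  have h1 : acoT2 1 = 1 := rfl
  have h2 : acoT2 2 = 1 / 4 := rfl
  simp only [Finset.sum_range_succ, Finset.sum_range_zero, h0, h1, h2, ChebyshevU.c1_0, ChebyshevU.c1_1, ChebyshevU.c1_2]
  ring

/-- The two-point counting step for ten unit vectors: if `Σ_{x,y ∈ C} (p⟪x,y⟫ - a₀) ≥ 0` (positive definiteness of `p - a₀`),
then `Σ_{x≠y} p⟪x,y⟫ ≥ 100 a₀ - 10 p(1)` (the ten diagonal terms have `⟪x,x⟫ = 1`). -/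
theorem sum_erase_of_pairSum (C : Finset (EuclideanSpace ℝ (Fin 4))) (hC : ∀ x ∈ C, ‖x‖ = 1) (h10 : C.card = 10)
    (p : ℝ → ℝ) (a0 : ℝ) (hA : 0 ≤ ∑ x ∈ C, ∑ y ∈ C, (p (inner ℝ x y) - a0)) :
    100 * a0 - 10 * p 1 ≤ ∑ x ∈ C, ∑ y ∈ C.erase x, p (inner ℝ x y) := by
  classical
  have hdiag : ∀ x ∈ C, ∑ y ∈ C, (p (inner ℝ x y) - a0) = (p 1 - a0) + ∑ y ∈ C.erase x, (p (inner ℝ x y) - a0) := by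
    intro x hx
    rw [← Finset.add_sum_erase C _ hx, real_inner_self_eq_norm_sq, hC x hx]
    norm_num
  rw [Finset.sum_congr rfl hdiag, Finset.sum_add_distrib, Finset.sum_const, h10] at hA
  have hsplit : ∑ x ∈ C, ∑ y ∈ C.erase x, (p (inner ℝ x y) - a0)
      = ∑ x ∈ C, ∑ y ∈ C.erase x, p (inner ℝ x y) - ∑ x ∈ C, ∑ y ∈ C.erase x, a0 := by
    rw [← Finset.sum_sub_distrib]
    refine Finset.sum_congr rfl fun x _ => ?_
    rw [Finset.sum_sub_distrib]
  have hconst : ∑ x ∈ C, ∑ y ∈ C.erase x, a0 = 10 * 9 * a0 := by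
    rw [Finset.sum_congr rfl fun x hx => by rw [Finset.sum_const, Finset.card_erase_of_mem hx, h10]]
    rw [Finset.sum_const, h10]
    simp only [nsmul_eq_mul]; push_cast; ring
  rw [hsplit, hconst] at hA
  simp only [nsmul_eq_mul, Nat.cast_ofNat] at hA
  linarith

/-- **k = 1:** `Σ_{x≠y} (1 + ⟪x,y⟫) ≥ 80` for every ten unit vectors of `ℝ⁴` (i.e. `‖Σ x‖² ≥ 0`). -/
theorem ck1_ten_points (C : Finset (EuclideanSpace ℝ (Fin 4))) (hC : ∀ x ∈ C, ‖x‖ = 1) (h10 : C.card = 10) :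
    (80 : ℝ) ≤ ∑ x ∈ C, ∑ y ∈ C.erase x, (1 + inner ℝ x y) := by
  classical
  have hA := pairSum_gegenbauer_comb_nonneg (n := 4) (by norm_num) 1 acoT1 aco_nonnegT1 C hC
  simp only [BachocVallentin.pairSum, aeval_T1] at hA
  have h := sum_erase_of_pairSum C hC h10 (fun t => 1 + t) 1 hA
  norm_num at h
  linarith

/-- **k = 2:** `Σ_{x≠y} (1 + ⟪x,y⟫)² ≥ 85` for every ten unit vectors of `ℝ⁴`. -/
theorem ck2_ten_points (C : Finset (EuclideanSpace ℝ (Fin 4))) (hC : ∀ x ∈ C, ‖x‖ = 1) (h10 : C.card = 10) :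
    (85 : ℝ) ≤ ∑ x ∈ C, ∑ y ∈ C.erase x, (1 + inner ℝ x y) ^ 2 := by
  classical
  have hA := pairSum_gegenbauer_comb_nonneg (n := 4) (by norm_num) 2 acoT2 aco_nonnegT2 C hC
  simp only [BachocVallentin.pairSum, aeval_T2] at hA
  have h := sum_erase_of_pairSum C hC h10 (fun t => (1 + t) ^ 2) (5 / 4) hA
  norm_num at h
  linarith

/-- Two orthogonal regular pentagons attain `80` and `85`. -/
theorem pentagons_ck12_energy : ∃ C : Finset (EuclideanSpace ℝ (Fin 4)), C.card = 10 ∧ (∀ x ∈ C, ‖x‖ = 1) ∧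
    ∑ x ∈ C, ∑ y ∈ C.erase x, (1 + inner ℝ x y) = (80 : ℝ) ∧ ∑ x ∈ C, ∑ y ∈ C.erase x, (1 + inner ℝ x y) ^ 2 = (85 : ℝ) := by
  obtain ⟨C, hc, hn, _, he⟩ := OrthogonalPentagons.exists_config
  refine ⟨C, hc, hn, ?_, ?_⟩
  · rw [he (fun t : ℝ => 1 + t)]; ring
  · rw [he (fun t : ℝ => (1 + t) ^ 2)]
    have hX : Real.sqrt 5 ^ 2 = 5 := Real.sq_sqrt (by norm_num)
    linear_combination (5 / 2 : ℝ) * hX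

/-- The Petersen code also attains `80` and `85` (the two codes tie for `k ≤ 2`). -/
theorem petersen_ck12_energy : ∃ C : Finset (EuclideanSpace ℝ (Fin 4)), C.card = 10 ∧ (∀ x ∈ C, ‖x‖ = 1) ∧
    ∑ x ∈ C, ∑ y ∈ C.erase x, (1 + inner ℝ x y) = (80 : ℝ) ∧ ∑ x ∈ C, ∑ y ∈ C.erase x, (1 + inner ℝ x y) ^ 2 = (85 : ℝ) := by
  obtain ⟨C, hc, hn, _, he⟩ := PetersenCode.exists_config
  refine ⟨C, hc, hn, ?_, ?_⟩
  · rw [he (fun t : ℝ => 1 + t)]; norm_num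
  · rw [he (fun t : ℝ => (1 + t) ^ 2)]; norm_num

/-- **k = 1, two-sided:** least value `80`. -/
theorem ck1_ten_points_isLeast :
    IsLeast {E : ℝ | ∃ C : Finset (EuclideanSpace ℝ (Fin 4)), C.card = 10 ∧ (∀ x ∈ C, ‖x‖ = 1) ∧
      E = ∑ x ∈ C, ∑ y ∈ C.erase x, (1 + inner ℝ x y)} (80 : ℝ) := by
  obtain ⟨C0, hc0, hn0, he0, -⟩ := pentagons_ck12_energy
  refine ⟨⟨C0, hc0, hn0, he0.symm⟩, ?_⟩
  rintro E ⟨C, h10, hC, rfl⟩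
  exact ck1_ten_points C hC h10

/-- **k = 2, two-sided:** least value `85`. -/
theorem ck2_ten_points_isLeast :
    IsLeast {E : ℝ | ∃ C : Finset (EuclideanSpace ℝ (Fin 4)), C.card = 10 ∧ (∀ x ∈ C, ‖x‖ = 1) ∧
      E = ∑ x ∈ C, ∑ y ∈ C.erase x, (1 + inner ℝ x y) ^ 2} (85 : ℝ) := by
  obtain ⟨C0, hc0, hn0, -, he0⟩ := pentagons_ck12_energy
  refine ⟨⟨C0, hc0, hn0, he0.symm⟩, ?_⟩
  rintro E ⟨C, h10, hC, rfl⟩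
  exact ck2_ten_points C hC h10

end Summit.Ventures.PackingBounds.Energy.TenPointCkSmall
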